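import Mathlib
import HarnessLib
import Summits.QuantumFields.YangMills.Theses.MirrorModularBoosts

/-!
# PROPOSAL (compiled, for the route planner of MirrorModularBoosts / IsotropyFromPowerCounting) — re-glue `closes` to child 1
# `CurvatureKernelBoundWeakCoupling` of the split D1 of crux stmt-QuantumFields-11687 (lead c11, 2026-08-17)

The strategist's decomposition D1 (`STRATEGY-CENSUS.md` §3; `children.json` v-s1 = evidence #77/#9x on the item; glue LANDED as
`Summit.QuantumFields.YangMills.Theorems.CurvatureKernel.CurvatureKernelBound_of_subs`, p137385) splits the universal crux
`CurvatureKernelBound` (quantified over EVERY scaling scheme) into WeakCoupling / FiniteCoupling / NegativeCoupling; every route's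
`closes` feeds the crux only the weak-coupling witness (`hweak : sch.HasWeakCouplingLimit`). By-name readbacks of the ONE-TOKEN re-glue exist
for PencilRigidity (`SplitReadback.lean`) and CertificationLength (`SplitReadbackCL.lean`); this file is the compiled re-glue for
MirrorModularBoosts (whose `closes` bundles the crux into the universal engine `hEng : CurvatureBoostCovariance`, so the edit is the
five-line move "apply child 1 at the witness"), hence also for IsotropyFromPowerCounting (`closes := MirrorModularBoosts.closes hK …`).

Contents: `CurvatureKernelBoundWeakCoupling` — child 1 VERBATIM as in `children.json` (= `CouplingTrichotomy.Child.WeakCoupling` of the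
registered skeleton `Lines/coupling_trichotomy.lean`); `curvatureKernelBoundWeakCoupling_of_parent` (the child is WEAKER than the parent);
`closes_child1 : CurvatureKernelBoundWeakCoupling → SoftKernelBoostCovariance → PlanarSpectralCone → DiagonalMirrorRPR →
WeakCouplingHypercubicLimit → YangMills` — the tree's `MirrorModularBoosts.closes` VERBATIM except that the universal `hEng` block is
deleted and `hplanar` is obtained from `hSoft … (hKBw … hweak)` at the witness. rc 0, 0 sorries. After the planner applies
`route edit --split CurvatureKernelBound --into children.json --glue-by …CurvatureKernelBound_of_subs` on any of the four routes and installs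
this `closes`, children 2–3 (FiniteCoupling, NegativeCoupling) are not load-bearing for MirrorModularBoosts and can be dropped.
-/

namespace Summit.QuantumFields.YangMills.Theses.MirrorModularBoosts

namespace Child1Proposal

/-- **Child 1 of split D1 — `CurvatureKernelBoundWeakCoupling`** (VERBATIM `children.json`): the crux `CurvatureKernelBound` restricted to
schemes with `sch.HasWeakCouplingLimit` (`β_k → +∞`), the UV half of the 4D Yang–Mills construction at the asymptotically free fixed
point — the only form any route's `closes` instantiates. [JaffeWitten2000 §6; Balaban1989LargeFieldII] -/
def CurvatureKernelBoundWeakCoupling : Prop :=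
  open Literature.MathematicalPhysics.QuantumLattice Literature.MathematicalPhysics.AQFT Literature.MathematicalPhysics.QuantumFieldTheory in let E := EuclideanSpace ℝ (Fin 4); ∀ (G : Type) [Group G] [TopologicalSpace G] [IsTopologicalGroup G] [CompactSpace G], IsCompactSimpleLieGroup G → letI : MeasurableSpace G := borel G; haveI : BorelSpace G := ⟨rfl⟩; let W₁ := fun (r : LatticeRep G) (sch : SpeciesScheme (YMSpecies G)) (S₁ : SchwingerFamily E) => ((∀ (n : ℕ), n ≠ 0 → ∀ (f : Fin n → SchwartzMap (E) ℝ) (F : SchwartzMap (Fin n → E) ℂ), IsTensorOf F (fun i => ofRealTest (f i)) → IsOffDiagonal F → Filter.Tendsto (fun k : ℕ => ((latticeSchwinger r.ρ sch (fun s => s.F) k n (fun _ => r.curvature) f : ℝ) : ℂ)) Filter.atTop (nhds (S₁ n F))) ∧ (S₁.toLabelled.IsNormalized ∧ S₁.toLabelled.IsHermitian ∧ S₁.toLabelled.HasLinearGrowth ∧ S₁.toLabelled.IsReflectionPositive ∧ S₁.toLabelled.IsSymmetric ∧ S₁.toLabelled.HasClusterProperty) ∧ (∀ (n : ℕ) (a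 : E) (F : SchwartzMap (Fin n → E) ℂ), IsOffDiagonal F → S₁ n (translateMulti a F) = S₁ n F) ∧ (∀ (R : E ≃ₗᵢ[ℝ] E), LinearMap.det (R.toLinearEquiv : E →ₗ[ℝ] E) = 1 → (∀ i : Fin 4, ∃ j : Fin 4, R (EuclideanSpace.single i 1) = EuclideanSpace.single j 1 ∨ R (EuclideanSpace.single i 1) = -EuclideanSpace.single j 1) → ∀ (n : ℕ) (F : SchwartzMap (Fin n → E) ℂ), IsOffDiagonal F → S₁ n (linActMulti R F) = S₁ n F) ∧ (∃ Δ : ℝ, 0 < Δ ∧ S₁.toLabelled.HasMassGap Δ ∧ HasLatticeMassGap r sch Δ)); ∀ (r : LatticeRep G) (sch : SpeciesScheme (YMSpecies G)) (S₁ : SchwingerFamily E), W₁ r sch S₁ → sch.HasWeakCouplingLimit → ∃ (K : E → ℝ) (C η : ℝ), 0 < η ∧ ContinuousOn K {x : E | x ≠ 0} ∧ (∀ x : E, x ≠ 0 → |K x| ≤ C * (1 + ‖x‖ ^ (η - 10))) ∧ ∀ F : SchwartzMap (Fin 2 → E) ℂ, IsOffDiagonal F → MeasureTheory.Integrable (fun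 x : Fin 2 → E => (K (x 0 - x 1) : ℂ) * F x) ∧ S₁ 2 F = ∫ x : Fin 2 → E, (K (x 0 - x 1) : ℂ) * F x

/-- The child is WEAKER than the parent crux (sanity). [folklore] -/
theorem curvatureKernelBoundWeakCoupling_of_parent (h : CurvatureKernelBound) : CurvatureKernelBoundWeakCoupling := by
  intro G _ _ _ _ hG W₁ r sch S₁ hW₁ _
  exact h G hG r sch S₁ hW₁

/-- **The re-glued deciding theorem of MirrorModularBoosts** — `closes` VERBATIM with `hKB : CurvatureKernelBound` replaced by child 1
`hKBw : CurvatureKernelBoundWeakCoupling`, applied at the weak-coupling witness. [folklore] -/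
theorem closes_child1 (hKBw : CurvatureKernelBoundWeakCoupling) (hSoft : SoftKernelBoostCovariance)
    (hCone : PlanarSpectralCone) (hDiag : DiagonalMirrorRPR)
    (hWHL : WeakCouplingHypercubicLimit) : YangMills := by
  -- crux-only deciding theorem (human ruling 2026-08-16), re-elaborated after the Statement re-type
  -- p116790 (`YangMills` gained the conjunct `sch.HasWeakCouplingLimit`): the existence leg is now the
  -- WEAK-COUPLING hypercubic limit (HypercubicLimit ∧ β_k → ∞ for the SAME scheme), and the weak-coupling
  -- clause rides unchanged through the species bookkeeping (`onlySpecies` keeps `β`). The proved support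
  -- items are USED through their landed proofs, never assumed — CurvatureChannel
  -- (Theorems.PencilRigidityCurvatureChannel), PlanarToEuclidean (Theorems.PencilRigidityPlanarToEuclidean);
  -- SpeciesProjectionPlanar is re-derived below from the tree's one-field reduction
  -- (Theorems.HypercubicLimit.Negative.OneFieldReduction); the pure-logic glue KernelBoundEngineGlue is inlined.
  have hCC : CurvatureChannel := _root_.Summit.QuantumFields.YangMills.Theorems.curvatureChannel_proof
  have hPE : PlanarToEuclidean := _root_.Summit.QuantumFields.YangMills.Theorems.PlanarToEuclidean_proof
  -- (lead c11 re-glue) the engine is NOT bundled universally any more: child 1 `CurvatureKernelBoundWeakCoupling` is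
  -- applied below at the weak-coupling WITNESS, where `hweak : sch.HasWeakCouplingLimit` is in scope.
  intro G i1 i2 i3 i4 hG
  letI : MeasurableSpace G := borel G
  haveI : BorelSpace G := ⟨rfl⟩
  -- the weak-coupling existence leg: scheme `sch` with `β_k → ∞` and the HypercubicLimit clauses `hW`
  obtain ⟨r, sch, S, hweak, hW⟩ := hWHL G hG
  obtain ⟨hW₁, hAxis⟩ := hCC G hG r sch S hW
  obtain ⟨hconv₁, hpkg₁, htr₁, hhyp₁, Δ₁, hΔ₁, hgap₁, hlat₁⟩ := hW₁
  -- the eight oriented mirror lines of the (x₀,x₁)-plane: axis frames from CurvatureChannel,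
  -- diagonal frames from DiagonalMirrorRPR (fed the whole curvature-channel package W₁, whose E0
  -- clause pins the degree-0 term that refuted the unrepaired DiagonalMirrorRP)
  have h8 : ∀ (R : EuclideanSpace ℝ (Fin 4) ≃ₗᵢ[ℝ] EuclideanSpace ℝ (Fin 4)) (a b : ℝ), a ^ 2 + b ^ 2 = 1 →
      (a = 0 ∨ b = 0 ∨ a ^ 2 = b ^ 2) →
      R (EuclideanSpace.single 0 1) = a • EuclideanSpace.single 0 1 + b • EuclideanSpace.single 1 1 →
      (Literature.MathematicalPhysics.QuantumLattice.SchwingerFamily.toLabelled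
        (fun n => (S n (fun _ => r.curvature)).comp
          (Literature.MathematicalPhysics.QuantumLattice.linActMulti R))).IsReflectionPositive := by
    intro R a b hab hcase hR
    rcases hcase with h0 | h0 | h0
    · exact hAxis R a b hab (Or.inl h0) hR
    · exact hAxis R a b hab (Or.inr h0) hR
    · have ha : a ^ 2 = 1 / 2 := by linarith
      have hb : b ^ 2 = 1 / 2 := by linarith
      exact hDiag G hG r sch (fun n => S n (fun _ => r.curvature))
        ⟨hconv₁, hpkg₁, htr₁, hhyp₁, Δ₁, hΔ₁, hgap₁, hlat₁⟩ R a b ha hb hR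
  obtain ⟨hnorm₁, hherm₁, hgrowth₁, hrp₁, hsymm₁, hclus₁⟩ := hpkg₁
  -- planar spectral cone, then the engine: planar rotations of the curvature channel
  have hcone := hCone (fun n => S n (fun _ => r.curvature)) hgrowth₁ hsymm₁ htr₁ h8
  have hplanar := hSoft G hG r sch (fun n => S n (fun _ => r.curvature))
    ⟨hconv₁, ⟨hnorm₁, hherm₁, hgrowth₁, hrp₁, hsymm₁, hclus₁⟩, htr₁, hhyp₁, Δ₁, hΔ₁, hgap₁, hlat₁⟩ h8 hcone
    (hKBw G hG r sch (fun n => S n (fun _ => r.curvature))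
      ⟨hconv₁, ⟨hnorm₁, hherm₁, hgrowth₁, hrp₁, hsymm₁, hclus₁⟩, htr₁, hhyp₁, Δ₁, hΔ₁, hgap₁, hlat₁⟩ hweak)
  -- species bookkeeping (formerly the proved support SpeciesProjectionPlanar, inlined): every
  -- species other than the curvature renormalised to zero (`onlySpecies sch r.curvature`, same `β`),
  -- the family extended by zero
  obtain ⟨⟨hnorm, hherm, hgrowth, hrp, hsymm, hclus, htr, hhyp⟩, hconv, hnt, hng, Δ, hΔ, hgap, hlat⟩ :=
    _root_.Summit.QuantumFields.YangMills.Theorems.HypercubicLimit.Negative.clauses_of_clauses₁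
      (_root_.Summit.QuantumFields.YangMills.Theorems.HypercubicLimit.Negative.clauses₁_of_clauses hW)
  have hrot' : ∀ (R : EuclideanSpace ℝ (Fin 4) ≃ₗᵢ[ℝ] EuclideanSpace ℝ (Fin 4)),
      LinearMap.det (R.toLinearEquiv : EuclideanSpace ℝ (Fin 4) →ₗ[ℝ] EuclideanSpace ℝ (Fin 4)) = 1 →
      R (EuclideanSpace.single 2 1) = EuclideanSpace.single 2 1 →
      R (EuclideanSpace.single 3 1) = EuclideanSpace.single 3 1 →
      ∀ (n : ℕ) (k : Fin n → Literature.MathematicalPhysics.QuantumFieldTheory.YMSpecies G)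
        (F : SchwartzMap (Fin n → EuclideanSpace ℝ (Fin 4)) ℂ),
        Literature.MathematicalPhysics.AQFT.IsOffDiagonal F →
        _root_.Summit.QuantumFields.YangMills.Theorems.HypercubicLimit.Negative.extendByZero r.curvature
            (_root_.Summit.QuantumFields.YangMills.Theorems.HypercubicLimit.Negative.restrictTo r.curvature S)
            n k (Literature.MathematicalPhysics.QuantumLattice.linActMulti R F) =
          _root_.Summit.QuantumFields.YangMills.Theorems.HypercubicLimit.Negative.extendByZero r.curvature
            (_root_.Summit.QuantumFields.YangMills.Theorems.HypercubicLimit.Negative.restrictTo r.curvature S)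
            n k F := by
    intro R hdet h2 h3 n k F hF
    by_cases hk : ∀ i, k i = r.curvature
    · rw [_root_.Summit.QuantumFields.YangMills.Theorems.HypercubicLimit.Negative.extendByZero_of_all
        r.curvature _ hk]
      exact hplanar R hdet h2 h3 n F hF
    · rw [_root_.Summit.QuantumFields.YangMills.Theorems.HypercubicLimit.Negative.extendByZero_of_not_all
        r.curvature _ hk]
      rfl
  have hE1 : (_root_.Summit.QuantumFields.YangMills.Theorems.HypercubicLimit.Negative.extendByZero
      r.curvature
      (_root_.Summit.QuantumFields.YangMills.Theorems.HypercubicLimit.Negative.restrictTo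
        r.curvature S)).IsEuclideanInvariant :=
    ⟨htr, fun n k R hdet F hF =>
      hPE (Literature.MathematicalPhysics.QuantumFieldTheory.YMSpecies G) _ hhyp hrot' n k R hdet F hF⟩
  -- the weak-coupling clause of the species-projected scheme: `onlySpecies` only zeroes `c`, so its
  -- inverse bare coupling IS `sch.β` and the clause is `hweak` verbatim
  have hweak' : (_root_.Summit.QuantumFields.YangMills.Theorems.HypercubicLimit.Negative.onlySpecies
      sch r.curvature).HasWeakCouplingLimit := hweak
  -- the Osterwalder–Schrader data and the clauses of `YangMills` (weak coupling first)
  exact ⟨r, _, ⟨_, hnorm, hherm, hgrowth, hE1, hrp, hsymm, hclus⟩, hweak', hconv, hnt, hng, Δ, hΔ, hgap, hlat⟩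

end Child1Proposal

end Summit.QuantumFields.YangMills.Theses.MirrorModularBoosts
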